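import Literature.Barriers.CriticalPhenomena.LongRangeTrivialityOnZ3Reduction
import Literature.Barriers.CriticalPhenomena.LongRangeTrivialityOnZ3CriticalBeta
import Literature.Barriers.CriticalPhenomena.LongRangeTrivialityOnZ3Thm12Holds

/-!
# Audit (D-0021) of `LongRangeTrivialityOnZ3Reduction.lean`: the reduction to Theorem 1.2 alone,
# and the scope of its `β_c = 0` branch

Barrier catalogue `Literature/Barriers/CriticalPhenomena/` (D-0021), sub-problem `Ising3DConformalLimit`.
Audit record (refuter, barrier-audit mode, 2026-08-17, pool `c04dab0d11` generation 2) for the sibling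
`LongRangeTrivialityOnZ3Reduction.lean` of the barrier `LongRangeTrivialityOnZ3` — the file proving
`LongRangeTrivialityOnZ3.of_thm12 (h12 : panis_thm12) : LongRangeTrivialityOnZ3` by the case split
`β_c = 0` (independent fair signs, `tendsto_mgfDeviation_zero`) / `β_c > 0` (Theorem 1.2 at `β = β_c`).
That file contains theorems only (no definition, no named fact), so nothing in it is refutable; the
audit bears on (A) its trust base, (B) the scope of the `β_c = 0` branch, (C) the faithfulness of the
`β_c` convention against the source, (D) three stale sentences of its module docstring, and (E) the
literature since. Everything below is PROVED; no definition and no named fact is introduced (D-0026).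
A separate leaf file is used so that the modules importing `…Reduction` (`…Inputs` and, through it,
`…InputsProofs`, `…LeeYang`, `…TwoPoint`, `…Moments`, `…Thm12Holds`, the route file
`Summits/CriticalPhenomena/Ising3DConformalLimit/Theses/LongRangeEndpoint.lean`) are not rebuilt.

## Verdict: CONFIRMED

### A. Trust base (CONFIRMED: the reduction is now an unconditional theorem)

The only hypothesis of `LongRangeTrivialityOnZ3.of_thm12` is the named fact `panis_thm12`, which is
the theorem `panis_thm12_holds` (`LongRangeTrivialityOnZ3Thm12Holds.lean`, torus route, every `d ≥ 1`).
The composition `LongRangeTrivialityOnZ3.of_thm12 panis_thm12_holds` (an `example` below) elaborates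
and depends on the axioms `propext`, `Classical.choice`, `Quot.sound` only (`lean check --axioms`,
2026-08-17); so does the interaction-uniformity no-go, stated unconditionally for the first time as
`not_interactionUniformZ3_hasNonGaussianSmearingZ3`. This is a THIRD unconditional derivation of the
formal barrier, next to `LongRangeTrivialityOnZ3_holds` (`…Holds.lean`, from the
infrared bound alone, `LongRangeTrivialityOnZ3.of_irb`) and `of_facts` with its three facts discharged
(`panis_thm12_holds`, `panis_variance_bound_holds`, `panis_criticalBeta_pos_holds`).

### B. Scope of the `β_c = 0` branch (a CONVENTION branch: void on the catalogued class, junk off it)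

`LongRangeIsing.criticalBeta J = sInf {β > 0 | m*(β) > 0}` with Mathlib's `sInf ∅ = 0`, so
`criticalBeta J = 0` happens in exactly two ways: (i) NO transition is recorded (`m*(β) ≤ 0` for every
`β > 0`; e.g. `J = 0`: `LongRangeIsing.criticalBeta_zero_coupling` below, by Fisher's bound
`magnetization_nonpos_of_mul_lt_one` with row-sum bound `S = 0`), or (ii) a transition at EVERY `β > 0`
(`inf = 0` genuinely; on paper every NON-summable ferromagnetic `J ≥ 0` is of this kind — e.g.
`J ≡ 1` off the diagonal: in the box `Λ_L` with field `h > 0` the weight of `{∑σ = |Λ_L| - 2k}` relative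
to the all-plus configuration is at most `|Λ_L|^k e^{-2βk(|Λ_L|-k) - 2βhk}`, so `⟨σ₀⟩_{Λ_L,β,h} → 1` as
`L → ∞` and `m*(β) = 1` for every `β > 0` [folklore]; not formalised). In both cases
`¬ HasNonGaussianSmearingZ3 J` (`not_hasNonGaussianSmearingZ3_of_criticalBeta_eq_zero`) asserts the
Gaussianity of the INFINITE-TEMPERATURE smearings `T_{f,L,0}` — true for every `J ≥ 0` whatsoever
(`tendsto_mgfDeviation_zero`: the CLT for independent fair signs) — and says nothing about a critical
state: in case (ii) the states at small `β > 0` are ordered and their block laws are not Gaussian at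
all. The branch is therefore "Gaussian by convention", not by a mechanism. It is VOID on the
catalogued family: `Z3Model.criticalBeta_coupling_pos` below — `0 < β_c` for the nearest-neighbour
member (`criticalBeta_nnCoupling_pos`: Fisher's bound with the row sums of `J_nn` at most `3^d`, and
Peierls–Griffiths `m*(4) ≥ ½` from `half_le_magnetization`, `d ≥ 2`) and for every algebraic member
(`panis_criticalBeta_pos_holds`), with `β_c ≤ 4` resp. `β_c ≤ 4/C₀` (`criticalBeta_nnCoupling_le_four`,
`criticalBeta_le`) — the printed "`β_c ∈ (0,∞)`". Consequently `of_thm12` never uses its `β_c = 0`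
branch on `Z3Model` (the second `example` of §A below re-derives the barrier from the `β_c > 0`
branch and `panis_criticalBeta_pos_holds` alone), and the branch carries none of the
barrier's bite: the bite comes from the members `0 < α < 3/2`, which are summable, `0 < β_c < ∞`, and
Gaussian AT their critical point by Theorem 1.2. Where the branch IS live is inside the hypothesis-
defined sharpened classes of the sibling audits (`BubbleTrivialityOnZ3`, `SusceptibilityTrivialityOnZ3`,
`LayeredTrivialityOnZ3`: "every translation-invariant `J ≥ 0` with …"), which admit `J = 0`, reducible
decoupled `J` and non-summable `J` as members with `β_c = 0`; for those members "Gaussian critical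
smearings" is to be read as case (i)/(ii) above — harmless for every use made of those classes in the
tree (their theorems are proved, and every contrary model actually exhibited there has `0 < β_c < ∞`),
but a planner must not cite such a membership as information about a critical point. Scope caveat
proposed for the parent block: "(w) `criticalBeta J = 0` is the `sInf ∅ = 0` / `inf = 0` convention
branch — infinite temperature, Gaussian for every `J` — void on `Z3Model` (`Z3Model.criticalBeta_coupling_pos`),
inhabited off it by `J = 0` (`criticalBeta_zero_coupling`) and, on paper, by non-summable `J ≥ 0`."

Hypothesis mutation (information for provers, not formalised): in
`not_hasNonGaussianSmearingZ3_of_criticalBeta_eq_zero` / `blockVariance_zero` / `tendsto_mgfDeviation_zero`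
the hypothesis `J ≥ 0` enters only through `blockVariance_eq_sum` / `state_sum₂` (existence of the
thermodynamic limit by Griffiths monotonicity); at `β = 0` every box expectation is eventually constant
(`expectIn_zero_prod`), so `J ≥ 0` is unnecessary there. The hypothesis `1 ≤ d` of
`tendsto_mgfDeviation_zero` IS necessary: for `d = 0` the lattice is one site, `T_{f,L,0} = f(0)σ₀` and
`⟨e^{zT}⟩ = cosh(z f(0)) ≠ e^{z²f(0)²/2}` for `z f(0) ≠ 0`.

### C. Faithfulness of the `β_c` convention (CONFIRMED, with the convention made explicit)

Source, verbatim (arXiv:2309.05797 §1.2.1, p. 6): "if (A1)–(A5) hold, the model undergoes a phase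
transition … then, `β_c := inf{β > 0, m*(β) > 0} ∈ (0,∞)`. The above assumptions guarantee [Fisher 1967]
that `β_c > 0` (in fact `β_c ≥ |J|⁻¹`), while Peierls' celebrated argument yields `β_c < ∞`. In dimension
`d = 1`, the phase transition occurs [Dyson 1969] under the additional assumption that
`J_{x,y} ≍ |x-y|^{-1-α}` with `α ∈ (0,1]`." [cite: Panis2023Triviality, §1.2.1 (definition of β_c), p. 6]
So the source defines `β_c` only under (A1)–(A5) (in particular (A2) `|J| = ∑ₓ J_{0,x} < ∞`), where the
set is non-empty and bounded below; the tree's total function `criticalBeta` extends it by `sInf ∅ = 0`,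
and the Reduction's `β_c = 0` branch is exactly the extension. Theorem 1.2 / Theorem 5.5 are printed
"for all `β ≤ β_c`, `L ≥ 1`, `f ∈ C₀(ℝ^d)` and `z ∈ ℝ`" with right-hand side
`exp((z²/2)⟨T_{|f|,L,β}²⟩_β)·C(β⁻⁴ ∨ β⁻²)‖f‖⁴_∞ r_f^γ z⁴/L^{d+2η-4}`, `d + 2η - 4 = d - 2(α∧2)` under
Remark 5.4 [cite: Panis2023Triviality, Theorem 5.5 and Remark 5.4, p. 21]; the vendored `panis_thm12`
(`0 < β ≤ β_c`, `C_f` absorbing `‖f‖⁴_∞ r_f^γ`) is weaker than printed and is a theorem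
(`panis_thm12_holds`). The uniform-in-`L` bound on the exponent `⟨T_{|f|,L,β_c}²⟩ ≤ C_{|f|}` that
`not_hasNonGaussianSmearingZ3_of_thm12` needs is `panis_variance_bound_holds` (audited in
`LongRangeTrivialityOnZ3ProofsAudit.lean`). The footnote on p. 6 — "At a parameter `β < β_c`,
finiteness of the susceptibility [Aizenman–Barsky–Fernández 1987] implies that the scaling limit is
the (Gaussian) white noise [Newman 1980]" — places the Reduction's `β = 0` computation as the trivial
instance of subcritical white noise. [cite: Panis2023Triviality, §1.2.1 (footnote on β < β_c), p. 6]

### D. Three stale sentences in the audited module docstring (documentation only, non-blocking)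

(1) "`panis_criticalBeta_pos` … undischarged; with the tree's definition … its proof needs the
spontaneous magnetisation of the free-boundary-plus-field state, i.e. uniqueness at `h ≠ 0`" — it is
DISCHARGED (`panis_criticalBeta_pos_holds`, `…CriticalBeta.lean`, 2026-08-16) WITHOUT uniqueness: Fisher's
bound `⟨σ₀⟩_{J,h,β} ≤ βh/(1-β|J|)` on the free state with field (`state_spinAt_le_of_sum_le`) and the
Griffiths–Peierls pressure bound `⟨σ₀⟩_{J,h,β} ≥ ½` for `βC₀ ≥ 4` (`half_le_state_spinAt`), both for
the free-boundary box limits that define `magnetization`. (2) "So the formal barrier now rests on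
`panis_thm12` only … none of it is in the tree for long-range `J`" — OUTDATED: every listed input is in
the tree and `panis_thm12_holds` is proved (`…Thm12Holds.lean`; MMS `…InputsProofs`, infrared bounds
`…InfraredBoundHolds`, sliding-scale bound and tree diagram bound `…TreeDiagram`, Lee–Yang / moments
`…LeeYang`). (3) Among the "printed inputs", "Proposition 4.6 … in the form of the first display of the
proof of Theorem 5.5" — that display, as first vendored (`panis_evenMoment_deviation_le`), is REFUTED in
the tree (`not_panis_evenMoment_deviation_le_of_criticalBeta_pos`, `…Wick.lean`) and replaced by the Wick
form `panis_evenMoment_deviation_le_wick` (`…Moments.lean`, §Verdict); the printed display (p. 21: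
"`|⟨T^{2n}⟩ - (2n)!/(2ⁿn!)⟨T²⟩ⁿ| ≤ (3/2)(2n)⁴⟨T_{|f|}^{2n-4}⟩‖f‖⁴_∞ S(β,L,f)`") is the one audited there.
[cite: Panis2023Triviality, proof of Theorem 5.5 (first display), p. 21]

### E. Literature since the barrier was written (nothing evades or contradicts it)

Searches 2026-08-17 (corpus fts+vec, citation graph; OpenAlex/S2/arXiv rate-limited, zbMATH/Crossref
answered; galaxy saturated twice — `search-degraded: galaxy`): the source is published, R. Panis,
Ann. Probab. 54 (2026) 892–972, doi:10.1214/25-aop1782 [zbMATH]; its 8 forward citations in the local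
graph (Duminil-Copin–Panis arXiv:2404.05700 = CMP 2025 — nearest-neighbour `ℤ³`: `B(β_c) = ∞`, `η ≤ 1/2`,
the non-interaction-uniform input already catalogued under evasions_known; arXiv:2502.12104, EJP 2025 —
random-walk two-point functions for high-dimensional long-range models; Liu–Panis–Slade torus plateau
arXiv:2405.17353; one-arm exponents arXiv:2510.23423; percolation / WSAW analogues arXiv:2410.03647,
2410.03649) and the 2026 preprint Duminil-Copin–Markar–Panis–Slade arXiv:2605.21438 ("a 'black box'
proof of mean-field near-critical behaviour … all above their upper critical dimensions") all sit on the
`d_eff > 4` side; Gunaratnam–Panis (AIHP 2025, doi:10.1214/24-aihp1472) is subcritical. No printed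
non-Gaussianity for any reflection-positive long-range member with `α < 3/2` on `ℤ³` (it would contradict
a refereed theorem), and no printed non-triviality for the nearest-neighbour model on `ℤ³`.

## Contents (all in namespace `Literature.Barriers.CriticalPhenomena`)

* `LongRangeIsing.magnetization_zero_coupling_nonpos`, `LongRangeIsing.criticalBeta_zero_coupling`,
  `not_hasNonGaussianSmearingZ3_zero_coupling` (the branch is inhabited by `J = 0`);
* `LongRangeIsing.nnCoupling_symm`, `card_filter_l1Norm_sub_eq_one_le`,
  `sum_nnCoupling_le`, `four_mem_nnCoupling`, `inv_le_of_mem_nnCoupling`,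
  `inv_three_pow_le_criticalBeta_nnCoupling`, `criticalBeta_nnCoupling_pos`,
  `criticalBeta_nnCoupling_le_four` (`3^{-d} ≤ β_c(J_nn) ≤ 4`, `d ≥ 2`);
* `Z3Model.criticalBeta_coupling_pos` (the branch is void on the catalogued family);
* two `example`s (`of_thm12 panis_thm12_holds`; the `β_c > 0` branch alone) and
  `not_interactionUniformZ3_hasNonGaussianSmearingZ3` (trust base; the unconditional no-go).

## References

* R. Panis, arXiv:2309.05797 = Ann. Probab. 54 (2026) 892–972: §1.2.1 p. 6 (β_c, footnote), Theorem 1.2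
  p. 6, Theorem 5.5 / Remark 5.4 p. 21 [Panis2023Triviality] (held; pages read 6, 13–14, 16, 20–22).
* S. Friedli, Y. Velenik, Statistical Mechanics of Lattice Systems (2017), Thm. 3.49 (Griffiths),
  §3.7.2–3.7.3 (Peierls, high temperature) [FriedliVelenik2017] (background for B; not re-read here).
-/

noncomputable section

namespace Literature.Barriers.CriticalPhenomena

open Literature.Probability.LatticeModels Literature.Probability.Percolation Filter Topology Finset

namespace LongRangeIsing

variable {d : ℕ}

/-! ### B(i). The zero coupling: `β_c(0) = 0`, so the `β_c = 0` branch is inhabited -/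

/-- Fisher's bound with row sums `0`: the zero coupling has no spontaneous magnetisation at any
`β ≥ 0`. [folklore] -/
theorem magnetization_zero_coupling_nonpos {β : ℝ} (hβ : 0 ≤ β) :
    magnetization (0 : Site d → Site d → ℝ) β ≤ 0 :=
  magnetization_nonpos_of_mul_lt_one 0 β hβ (fun _ _ => le_rfl) (fun _ _ => rfl) (S := 0)
    (fun L x _ => by simp) (by simp)

/-- **`β_c(J = 0) = 0`**: the set `{β > 0 | m*(β) > 0}` is empty and `sInf ∅ = 0` — the `β_c = 0`
branch of `LongRangeTrivialityOnZ3.of_thm12` is inhabited (off the catalogued family). [folklore] -/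
theorem criticalBeta_zero_coupling : criticalBeta (0 : Site d → Site d → ℝ) = 0 := by
  have h : {β : ℝ | 0 < β ∧ 0 < magnetization (0 : Site d → Site d → ℝ) β} = ∅ := by
    ext β
    simp only [Set.mem_setOf_eq, Set.mem_empty_iff_false, iff_false, not_and, not_lt]
    exact fun hβ => magnetization_zero_coupling_nonpos hβ.le
  rw [criticalBeta, h, Real.sInf_empty]

/-! ### B(ii). The nearest-neighbour member: `3^{-d} ≤ β_c(J_nn) ≤ 4` for `d ≥ 2` -/

/-- `J_nn` is symmetric. [folklore] -/
theorem nnCoupling_symm (x y : Site d) : nnCoupling d x y = nnCoupling d y x := by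
  unfold nnCoupling
  rw [l1Norm_sub_comm]

/-- A site has at most `3^d` lattice points at `ℓ¹`-distance `1` inside any finite set (they lie in
the unit box around it). [folklore] -/
theorem card_filter_l1Norm_sub_eq_one_le (Λ : Finset (Site d)) (x : Site d) :
    #(Λ.filter fun y => l1Norm (x - y) = 1) ≤ 3 ^ d := by
  classical
  calc #(Λ.filter fun y => l1Norm (x - y) = 1)
      ≤ #((box d 1).image fun z => x - z) := by
        refine Finset.card_le_card fun y hy => ?_
        rw [Finset.mem_filter] at hy
        refine Finset.mem_image.2 ⟨x - y, ?_, sub_sub_cancel x y⟩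
        rw [mem_box]
        intro i
        have h1 : ((x - y) i).natAbs ≤ l1Norm (x - y) :=
          Finset.single_le_sum (fun j _ => Nat.zero_le (((x - y) j).natAbs)) (Finset.mem_univ i)
        rw [hy.2] at h1
        omega
    _ ≤ #(box d 1) := Finset.card_image_le
    _ = 3 ^ d := by simp [card_box]

/-- **Row sums of `J_nn` are at most `3^d`.** [folklore] -/
theorem sum_nnCoupling_le (Λ : Finset (Site d)) (x : Site d) :
    ∑ y ∈ Λ, nnCoupling d x y ≤ (3 : ℝ) ^ d := by
  have h : ∑ y ∈ Λ, nnCoupling d x y = (#(Λ.filter fun y => l1Norm (x - y) = 1) : ℝ) := by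
    simp only [nnCoupling, Finset.sum_boole]
  rw [h]
  exact_mod_cast card_filter_l1Norm_sub_eq_one_le Λ x

/-- **Peierls–Griffiths for `J_nn`, `d ≥ 2`: `m*(4) ≥ ½`**, so `4 ∈ {β > 0 | m*(β) > 0}`.
[cite: Panis2023Triviality, §1.2.1 (β_c < ∞, after Peierls 1936), p. 6] -/
theorem four_mem_nnCoupling (hd : 2 ≤ d) :
    (4 : ℝ) ∈ {β : ℝ | 0 < β ∧ 0 < magnetization (nnCoupling d) β} := by
  refine ⟨by norm_num, lt_of_lt_of_le (by norm_num : (0 : ℝ) < 1 / 2) ?_⟩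
  exact half_le_magnetization hd nnCoupling_nonneg
    (fun a x y => by simp only [nnCoupling, add_sub_add_right_eq_sub]) one_pos
    (fun x y hxy => le_of_eq (by rw [nnCoupling_eq_ite, if_pos hxy])) (by norm_num)

/-- **Fisher for `J_nn`: every `β > 0` with `m*(β) > 0` has `β ≥ 3^{-d}`.**
[cite: Panis2023Triviality, §1.2.1 (β_c ≥ |J|⁻¹, after Fisher 1967), p. 6] -/
theorem inv_le_of_mem_nnCoupling {β : ℝ}
    (hβ : β ∈ {β : ℝ | 0 < β ∧ 0 < magnetization (nnCoupling d) β}) : ((3 : ℝ) ^ d)⁻¹ ≤ β := by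
  have h1 : 1 ≤ β * (3 : ℝ) ^ d :=
    one_le_mul_of_magnetization_pos (nnCoupling d) β hβ.1.le nnCoupling_nonneg nnCoupling_symm
      (fun L x _ => sum_nnCoupling_le (box d L) x) hβ.2
  have h3 : (0 : ℝ) < 3 ^ d := by positivity
  rw [inv_le_iff_one_le_mul₀ h3]
  linarith

/-- `β_c(J_nn) ≥ 3^{-d}` for `d ≥ 2`. [cite: Panis2023Triviality, §1.2.1 (β_c ≥ |J|⁻¹), p. 6] -/
theorem inv_three_pow_le_criticalBeta_nnCoupling (hd : 2 ≤ d) :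
    ((3 : ℝ) ^ d)⁻¹ ≤ criticalBeta (nnCoupling d) :=
  le_csInf ⟨_, four_mem_nnCoupling hd⟩ fun _ hb => inv_le_of_mem_nnCoupling hb

/-- **`0 < β_c` for the nearest-neighbour model, `d ≥ 2`** — the `β_c = 0` branch of
`LongRangeTrivialityOnZ3.of_thm12` is void for this member. [cite: Panis2023Triviality, §1.2.1 (β_c ∈ (0,∞)), p. 6] -/
theorem criticalBeta_nnCoupling_pos (hd : 2 ≤ d) : 0 < criticalBeta (nnCoupling d) :=
  lt_of_lt_of_le (by positivity) (inv_three_pow_le_criticalBeta_nnCoupling hd)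

/-- **`β_c ≤ 4 < ∞` for the nearest-neighbour model, `d ≥ 2`.** [cite: Panis2023Triviality, §1.2.1 (β_c ∈ (0,∞)), p. 6] -/
theorem criticalBeta_nnCoupling_le_four (hd : 2 ≤ d) : criticalBeta (nnCoupling d) ≤ 4 :=
  csInf_le ⟨0, fun _ hb => hb.1.le⟩ (four_mem_nnCoupling hd)

end LongRangeIsing

open LongRangeIsing

/-! ### B(iii). The branch on and off the catalogued family -/

/-- **The zero coupling has "Gaussian critical smearings"** in the sense of the barrier — by the
`sInf ∅ = 0` convention: `β_c(0) = 0` and the smearings at `β = 0` are those of independent fair signs.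
The `β_c = 0` branch of the Reduction is inhabited, by junk. [folklore] -/
theorem not_hasNonGaussianSmearingZ3_zero_coupling :
    ¬ HasNonGaussianSmearingZ3 (0 : Site 3 → Site 3 → ℝ) :=
  not_hasNonGaussianSmearingZ3_of_criticalBeta_eq_zero (fun _ _ => le_rfl) criticalBeta_zero_coupling

/-- **Every member of `Z3Model` has `0 < β_c`**: the `β_c = 0` branch of
`LongRangeTrivialityOnZ3.of_thm12` is void on the catalogued family (nearest-neighbour: Fisher + Peierls
above; algebraic: `panis_criticalBeta_pos_holds`). [cite: Panis2023Triviality, §1.2.1 (β_c ∈ (0,∞)), p. 6] -/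
theorem Z3Model.criticalBeta_coupling_pos (m : Z3Model) : 0 < criticalBeta m.coupling := by
  cases m with
  | nearestNeighbour =>
      show 0 < criticalBeta (nnCoupling 3)
      exact criticalBeta_nnCoupling_pos (by norm_num)
  | algebraic C₀ α hC₀ hα =>
      show 0 < criticalBeta (algebraicCoupling 3 C₀ α)
      exact panis_criticalBeta_pos_holds 3 (by norm_num) C₀ α hC₀ hα

/-! ### A. Trust base: the reduction's hypothesis is a theorem -/

/-- **The barrier from Theorem 1.2 alone, unconditionally**: `of_thm12` composed with the tree's
discharge `panis_thm12_holds` (an `example`, the statement being that of `LongRangeTrivialityOnZ3_holds`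
of `…Holds.lean`, which derives it from the infrared bound instead). [cite: Panis2023Triviality, Theorem 1.2, p. 6] -/
example : LongRangeTrivialityOnZ3 :=
  LongRangeTrivialityOnZ3.of_thm12 panis_thm12_holds

/-- The same conclusion from the `β_c > 0` branch only: on the catalogued family the infinite-temperature
branch of `of_thm12` is never taken. [cite: Panis2023Triviality, Theorem 1.2 and §1.2.1 (β_c ∈ (0,∞)), p. 6] -/
example : LongRangeTrivialityOnZ3 :=
  fun C₀ α hC₀ hα hα' => not_hasNonGaussianSmearingZ3_of_thm12 panis_thm12_holds hC₀ hα hα'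
    (panis_criticalBeta_pos_holds 3 (by norm_num) C₀ α hC₀ hα)

/-- **The interaction-uniformity no-go, unconditionally**: non-Gaussian critical smearing is not an
interaction-uniform property on `ℤ³` (from Theorem 1.2 alone, `not_interactionUniformZ3_of_thm12`, and
the discharge `panis_thm12_holds`). [cite: Panis2023Triviality, Theorem 1.2, p. 6] -/
theorem not_interactionUniformZ3_hasNonGaussianSmearingZ3 :
    ¬ InteractionUniformZ3 fun m => HasNonGaussianSmearingZ3 m.coupling :=
  not_interactionUniformZ3_of_thm12 panis_thm12_holds

end Literature.Barriers.CriticalPhenomena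

end
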